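import Literature.NumberTheory.GelbartRogawski1991.LocalUnitarySplittingDatum
import Literature.NumberTheory.Automorphic.Liu2021.LemD1DataOfPlace
import HarnessLib

/-!
# Rank-one theta lifts to `U(3)` remember the splitting: `Θ_{s₁}(χ₁) ≅ Θ_{s₂}(χ₂) ≠ 0 ⇒ s₁ = s₂` (the `μ`-clause of [Liu2021, Lem. D.1 (3)] at `n = 3`) — ONE NAMED FACT

Topic `RepresentationTheory/MoeglinVignerasWaldspurger1987`; companion of `RankOneThetaLift.lean` (facts IV-1/IV-2) and
`RankOneThetaLiftCentralCharacter.lean` (the `χ`-clause, PROVED).  Row IV-4c3 of the Hodge/COR-CM interface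
(B-plan/B4-SPEC-IV4c-addendum.md §1, 2026-08-28), stated VERBATIM in the SECTION currency of those files at `N = 3`.

AS PRINTED. [Liu2021, App. D, Lemma D.1 (3)] (FJcycle.tex l. 5233; print p. 125): «(3) If `n ≥ 3`, then `ω(μ', ε', χ')`
is isomorphic to `ω(μ, ε, χ)` if and only if `(μ', ε', χ') = (μ, ε, χ)`.» with the proof sentence (l. 5255, p. 126)
«For (3), it is known when `n = 3` by [GR90, Proposition 5.1.4]. In fact, the same proof also works for `n > 3`.»
([GelbartRogawski1990] = S. Gelbart, J. Rogawski, *Exceptional representations and Shimura's integral for the local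
unitary group U(3)*, PS-Festschrift I (1990) 19–75 — NOT HELD by this project, acq-10743/13597; the statement is typed from
Liu's printed sentence, the `n = 3` proof is GR90's).  Here `ω(μ, ε, χ)` is the maximal quotient of the Weil
representation `ω_{μ,ε} = ω_ψ ∘ ι_μ` of `U(V)(F_v)` (splitting `ι_μ : U(V) → Mp(Res V ⊗ W_ε)` of Kudla type `μ`) on which
the centre `E_v¹` acts by `χ` — the rank-one theta lift of `χ` from `U(W_ε) = E_v¹`.

WHAT IS TYPED (the `μ`-clause, i.e. the two triples share the line `ε` and the lifts are compared through their
SPLITTINGS).  In the tree the local splittings over `ι` are arbitrary homomorphisms `s : U(J)(F_v) →* S̃p_ψ` with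
`proj ∘ s = ι` (`RankOneThetaLift.lean`); any two differ by a character `η` of `U(J)(F_v)` through the centre of `S̃p_ψ`
(`MpPsi.exists_character_of_proj_eq`, `LocalSplittingsDifferByCharacter.lean`), and Kudla's `μ`-splittings for the
admissible `μ` exhaust these twists, so «`ω(μ', ε, χ') ≅ ω(μ, ε, χ) ⇒ μ' = μ`» reads, parameter-free: **two sections
`s₁, s₂` over `ι` whose `χ₁`-, `χ₂`-coinvariant representations of `U(J)(F_v)` are isomorphic and non-zero are EQUAL**
(equivalently `Θ_s(χ) ⊗ η ≅ Θ_s(χ'') ≠ 0 ⇒ η = 1`).  `χ₁ = χ₂` then follows from the PROVED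
`rankOne_thetaChar_eq_of_areIsomorphicRep` and is deliberately not conjoined.  Stated at `N = 3` LITERALLY (the
consumer `HypD3` lives on a hermitian 3-space, and `n = 3` is the case with a printed proof); binders = those of
`mvw_IV4_rankOne_irreducibleOrZero` (non-split place `hE`, sections with `hs`/`hsm`, unitary continuous characters).
Proof routes recorded for the discharge (none attempted here): (i) [GelbartRogawski1990, §5] explicit models of the
rank-one lift to quasi-split `U(3)` (central character and exponents); (ii) [AtobeGan2017, Thms. 4.3/4.5] (L-parameters
of theta lifts: the splitting contributes the block `χ_W ⊗ S₂`, resp. `χ_W(|·|^{1/2} ⊕ |·|^{-1/2})`, of dimension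
`n − 1 = 2 ≠ 1`, so a twist by `η̃ ∘ det` is detected) with the local Langlands correspondence for `U(3)` (Rogawski).
Why `n ≥ 3` matters: at `n = 2` both blocks of the parameter are characters and may be exchanged by a twist.

NOT here: the `ε`-clause (row IV-4c1, separate file), the `χ`-clause (PROVED, `RankOneThetaLiftCentralCharacter.lean`),
the converse direction (IV-4(a)(b): `LocalSplittingsDifferByCharacter.lean`, `ImplementerTransport.lean`), split places.

## References
* [Liu2021] Y. Liu, *Fourier–Jacobi cycles and arithmetic relative trace formula*, Camb. J. Math. 9 (2021) =
  arXiv:2102.11518 — App. D Lem. D.1 (3) (l. 5233, p. 125) and its proof (l. 5255, p. 126).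
* [GelbartRogawski1990] S. Gelbart, J. Rogawski, PS-Festschrift I, Israel Math. Conf. Proc. 2 (1990) 19–75 — Prop. 5.1.4
  (NOT HELD; cited through [Liu2021]).
* [GelbartRogawski1991] S. Gelbart, J. Rogawski, Invent. Math. 105 (1991) — §3, pp. 461–462 (attribution of the local
  results on the rank-one lift to [GR90] §5).
* [AtobeGan2017] H. Atobe, W. T. Gan, Invent. Math. 210 (2017) = arXiv:1602.01299 — Thm. 4.3 (chunk p0011), Thm. 4.5
  (chunk p0012): L-parameters of local theta lifts for unitary dual pairs (proof route (ii)).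
* [MoeglinVignerasWaldspurger1987] MVW, LNM 1291, Chap. 3 §IV (the rank-one type I pair; currency of this folder).
-/

noncomputable section

namespace Literature.RepresentationTheory.MoeglinVignerasWaldspurger1987

open NumberField IsDedekindDomain
open scoped Matrix
open Literature.RepresentationTheory.HeisenbergGroup (MpPsi)
open Literature.NumberTheory.GelbartRogawski1991.UnitaryDualPair.LocalSplitting (iota LocalMp localSchrodinger)
open Literature.NumberTheory.Automorphic (SchwartzBruhat UnitaryGroup.localPi UnitaryGroup.localCenter UnitaryGroup.LocalRing
  UnitaryGroup.localCenter_comm)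
open Literature.NumberTheory.Automorphic.Liu2021 (AreIsomorphicRep)

/-- **[Liu2021, App. D Lem. D.1 (3)], `μ`-clause, at `n = 3` and a NON-SPLIT place** («if `n ≥ 3`, then `ω(μ', ε', χ')`
is isomorphic to `ω(μ, ε, χ)` if and only if `(μ', ε', χ') = (μ, ε, χ)`», l. 5233; proof «known when `n = 3` by [GR90,
Proposition 5.1.4]», l. 5255), READ AT THE TREE'S OBJECTS exactly as `mvw_IV4_rankOne_irreducibleOrZero` (with `N := 3`):
for `F` a number field, `E/F` quadratic, `c`, `δ` (`c δ = -δ ≠ 0`, `δ² = d`), `T ∈ M₃(F)` symmetric with `det T` a unit,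
`J = T ⊗ 1`, a finite place `v` with `E_v` a field, TWO splittings `s₁, s₂ : U(J)(F_v) →* S̃p_ψ` over `iota` with
`ω_{sᵢ} = (MpPsi.toRep (localSchrodinger F 3 T v)).comp sᵢ` smooth, a hermitian line `J₁`, unitary continuous characters
`χ₁, χ₂` of `U(J₁)(F_v) = E_v¹`: if the `χ₁`-coinvariants of `ω_{s₁}` under the centre are non-zero and the coinvariant
representations `Θ_{s₁}(χ₁)`, `Θ_{s₂}(χ₂)` of `U(J)(F_v)` (`TwistedCoinv.rep`) are isomorphic (`AreIsomorphicRep`), then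
`s₁ = s₂` — «the rank-one theta lift to `U(3)` determines the splitting», equivalently `Θ_s(χ) ⊗ η ≅ Θ_s(χ'') ≠ 0` for a
character `η` of `U(J)(F_v)` forces `η = 1`.  (Then `χ₁ = χ₂` by `rankOne_thetaChar_eq_of_areIsomorphicRep`.)  A named
fact (D-0014), not proved here; proof routes: [GelbartRogawski1990, §5] (explicit, `n = 3`) or [AtobeGan2017, Thms.
4.3/4.5] + LLC for `U(3)`. [cite: Liu2021, App. D Lemma D.1 (3) (l. 5233) and proof l. 5255 (= GelbartRogawski1990 Prop. 5.1.4, n = 3)] -/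
def rankOne_theta_twist_rigidity : Prop :=
  ∀ (F : Type) [Field F] [NumberField F] (E : Type) [Field E] [NumberField E] [Algebra F E]
    [Algebra.IsQuadraticExtension F E] (c : E ≃ₐ[F] E) (δ : E) (hcδ : c δ = -δ) (hδ : δ ≠ 0) (d : F)
    (hd : δ * δ = algebraMap F E d) (T : Matrix (Fin 3) (Fin 3) F) (hT : T.IsSymm) (_hTd : IsUnit T.det)
    (J : Matrix (Fin 3) (Fin 3) E) (hJ : J = T.map (algebraMap F E)) (v : HeightOneSpectrum (𝓞 F))
    (_hE : IsField (UnitaryGroup.LocalRing E v))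
    (s₁ s₂ : UnitaryGroup.localPi E c 3 J v →* LocalMp F 3 T v)
    (_hs₁ : ∀ g, MpPsi.proj _ (s₁ g) = iota F E c 3 hcδ hδ hd T hT hJ v g)
    (_hs₂ : ∀ g, MpPsi.proj _ (s₂ g) = iota F E c 3 hcδ hδ hd T hT hJ v g)
    (_hsm₁ : Representation.IsSmooth ((MpPsi.toRep (localSchrodinger F 3 T v)).comp s₁))
    (_hsm₂ : Representation.IsSmooth ((MpPsi.toRep (localSchrodinger F 3 T v)).comp s₂))
    (J₁ : Matrix (Fin 1) (Fin 1) E) (hJ₁ : J₁ 0 0 ≠ 0) (χ₁ χ₂ : UnitaryGroup.localPi E c 1 J₁ v →* ℂˣ)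
    (_hχ₁u : ∀ z, ‖((χ₁ z : ℂˣ) : ℂ)‖ = 1) (_hχ₁c : Continuous fun z => ((χ₁ z : ℂˣ) : ℂ))
    (_hχ₂u : ∀ z, ‖((χ₂ z : ℂˣ) : ℂ)‖ = 1) (_hχ₂c : Continuous fun z => ((χ₂ z : ℂˣ) : ℂ))
    (_hnt : Nontrivial (TwistedCoinv.Coinv
      ((show Representation ℂ (UnitaryGroup.localPi E c 1 J₁ v) (SchwartzBruhat (Fin 3 → v.adicCompletion F)) from
        ((MpPsi.toRep (localSchrodinger F 3 T v)).comp s₁).comp (UnitaryGroup.localCenter E c 3 J J₁ hJ₁ v))) χ₁))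
    (_hiso : AreIsomorphicRep
      (TwistedCoinv.rep
        (ρW := show Representation ℂ (UnitaryGroup.localPi E c 1 J₁ v) (SchwartzBruhat (Fin 3 → v.adicCompletion F)) from
          ((MpPsi.toRep (localSchrodinger F 3 T v)).comp s₁).comp (UnitaryGroup.localCenter E c 3 J J₁ hJ₁ v))
        χ₁ ((MpPsi.toRep (localSchrodinger F 3 T v)).comp s₁)
        (fun g z => (show Commute g (UnitaryGroup.localCenter E c 3 J J₁ hJ₁ v z) from
          UnitaryGroup.localCenter_comm E c 3 J J₁ hJ₁ v z g).map ((MpPsi.toRep (localSchrodinger F 3 T v)).comp s₁)))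
      (TwistedCoinv.rep
        (ρW := show Representation ℂ (UnitaryGroup.localPi E c 1 J₁ v) (SchwartzBruhat (Fin 3 → v.adicCompletion F)) from
          ((MpPsi.toRep (localSchrodinger F 3 T v)).comp s₂).comp (UnitaryGroup.localCenter E c 3 J J₁ hJ₁ v))
        χ₂ ((MpPsi.toRep (localSchrodinger F 3 T v)).comp s₂)
        (fun g z => (show Commute g (UnitaryGroup.localCenter E c 3 J J₁ hJ₁ v z) from
          UnitaryGroup.localCenter_comm E c 3 J J₁ hJ₁ v z g).map ((MpPsi.toRep (localSchrodinger F 3 T v)).comp s₂)))),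
    s₁ = s₂

end Literature.RepresentationTheory.MoeglinVignerasWaldspurger1987

end
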